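import Summits.HodgeConjecture.HodgeConjecture.Cruxes.BlochSeedDiscOne.RBDoorChainSheafCrux
import Summits.HodgeConjecture.HodgeConjecture.Cruxes.BlochSeedDiscOne.SeedCheckerSplitBlock

/-!
# The R-B door chain, second terminus — v41's SHEAF-DOOR RUNG composes BY NAME to `SheafSeedGaussSq` (30548), window-free
# (leaf of `RBDoorChainSheafCrux.lean` v1.1 over c5c8-1's `SeedCheckerSplitBlock.lean` v41; seat `hsemireg-sheaf8-1` g9, 2026-08-31)

Token: `line stmt-HodgeConjecture-18881 Cruxes/BlochSeedDiscOne/Lines/birth.lean 814a6a70c14e831a stub_rung_pad4_seedAt`.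

HONEST FRAMING.  Wiring only; nothing here says 18881 ∕ 30548 ∕ H2 ∕ HC_AV ∕ HC_CM ∕ HC is proved; R-B ≠ 18881; typed ≠ proved.

Director R19.849 (3) ∕ R19.850 (1): the line `Cruxes/SheafSeedGaussSq/Lines/sheafdoor.lean` (to be registered on stmt-HodgeConjecture-30548) has the on-path
stub `stub_rung2aSheaf : ∀ C, Rung2aSheaf C {4} 14` (σ₃ ALONE — the strongest ask, the currency the closed shells price) and concludes the crux BY NAME.
THIS LEAF is that composition, ready to import: `SplitBlock.Rung2aSheaf C I h` (v41: on SOME CM anchor a split-block core passes the rank-free sheaf-seed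
checker in window `I`, shell design in normal form) ⟹ — re-windowed to `Finset.Icc 1 8` for free (`RBDoorChainSheafCrux.sheafSeedCheckRankFree_rewindow`:
`IsISemiregular.mono` + window-free `RealisedBy`) — `HasHyperbolicSeedOn (twistedReflexiveClass C AdmTw') 4 1` for that `C`, hence
`(∀ C, ∃ I h, Rung2aSheaf C I h) → SheafSeedGaussSq` and in particular `(∀ C, Rung2aSheaf C {4} 14) → SheafSeedGaussSq` (`sheafSeedGaussSq_of_rung2aSheaf_four`),
with NO window hypothesis and NO named fact; the same for the kernel orientation `Rung2aSheafK` and the law-carrying `Rung2aSheafLaw`.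
No `sorry`, no def, no instance, no notation; axioms standard.
-/

set_option linter.dupNamespace false
set_option autoImplicit false

noncomputable section

open CategoryTheory AlgebraicGeometry
open Literature.AlgebraicGeometry Literature.AlgebraicGeometry.Motives Literature.AlgebraicGeometry.HodgeTheory
open Literature.AlgebraicTopology.SingularHomology

namespace Summit.HodgeConjecture.HodgeConjecture.Cruxes.BlochSeedDiscOne.RBDoorChainSheafCrux

open Summit.HodgeConjecture.HodgeConjecture.Cruxes.BlochSeedDiscOne.Anchor
open Summit.HodgeConjecture.HodgeConjecture.Cruxes.BlochSeedDiscOne.SeedChecker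
open Summit.HodgeConjecture.HodgeConjecture.Cruxes.BlochSeedDiscOne.SeedChecker.SplitBlock
open Summit.Ventures.HSemireg Summit.Ventures.HSemireg.Pad4Tower

variable {C : ChernCharacterBetti} {E₀ : AbelianVariety ℂ} {ψ₀ : E₀ ⟶ E₀}

/-! ## §1 Re-windowing the sheaf-door verdicts of v41 -/

/-- a split-block CORE (cokernel orientation) passing the sheaf door at ANY window passes it at `{1, …, 8}`. [cite: BuchweitzFlenner2003, §5 (I-semiregular)] -/
theorem passesSheaf_rewindow (δ : SplitBlockCore C E₀ ψ₀) {I : Finset ℕ} (h : δ.PassesSheaf I) : δ.PassesSheaf (Finset.Icc 1 8) :=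
  sheafSeedCheckRankFree_rewindow h

/-- the same in the kernel orientation. [cite: BuchweitzFlenner2003, §5 (I-semiregular)] -/
theorem passesSheafK_rewindow (δ : SplitBlockCoreK C E₀ ψ₀) {I : Finset ℕ} (h : δ.PassesSheaf I) : δ.PassesSheaf (Finset.Icc 1 8) :=
  sheafSeedCheckRankFree_rewindow h

/-- RUNG 2a (sheaf door) at ANY window ⟹ RUNG 2a at `{1, …, 8}` (same anchor, same core, same scope rows). [cite: BuchweitzFlenner2003, §5 (I-semiregular)] -/
theorem rung2aSheaf_rewindow {I : Finset ℕ} {h : ℤ} (h2a : Rung2aSheaf C I h) : Rung2aSheaf C (Finset.Icc 1 8) h := by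
  obtain ⟨E₀, ψ₀, hE, hψ, δ, hδ, hscope⟩ := h2a
  exact ⟨E₀, ψ₀, hE, hψ, δ, passesSheaf_rewindow δ hδ, hscope⟩

theorem rung2aSheafK_rewindow {I : Finset ℕ} {h : ℤ} (h2a : Rung2aSheafK C I h) : Rung2aSheafK C (Finset.Icc 1 8) h := by
  obtain ⟨E₀, ψ₀, hE, hψ, δ, hδ, hscope⟩ := h2a
  exact ⟨E₀, ψ₀, hE, hψ, δ, passesSheafK_rewindow δ hδ, hscope⟩

/-! ## §2 v41's sheaf-door rung ⟹ the twisted seed of route № 3′'s crux, window-free -/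

/-- **`Rung2aSheaf C I h` (any window, any height) ⟹ `HasHyperbolicSeedOn (twistedReflexiveClass C AdmTw') 4 1`** — NO window hypothesis, NO named fact.
[cite: BuchweitzFlenner2003, §5 (I-semiregular)] -/
theorem hasHyperbolicSeedOn_admTwP_of_rung2aSheaf {I : Finset ℕ} {h : ℤ} (h2a : Rung2aSheaf C I h) :
    HasHyperbolicSeedOn (twistedReflexiveClass C AdmTwP) 4 1 :=
  hasHyperbolicSeedOn_admTwP_of_hasHyperbolicBFSheafSeedOn (Finset.isShiftedInitialSegment_Icc le_rfl 8)
    (hasHyperbolicBFSheafSeedOn_of_rung2aSheaf (rung2aSheaf_rewindow h2a))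

/-- kernel orientation. [cite: BuchweitzFlenner2003, §5 (I-semiregular)] -/
theorem hasHyperbolicSeedOn_admTwP_of_rung2aSheafK {I : Finset ℕ} {h : ℤ} (h2a : Rung2aSheafK C I h) :
    HasHyperbolicSeedOn (twistedReflexiveClass C AdmTwP) 4 1 :=
  hasHyperbolicSeedOn_admTwP_of_hasHyperbolicBFSheafSeedOn (Finset.isShiftedInitialSegment_Icc le_rfl 8)
    (hasHyperbolicBFSheafSeedOn_of_rung2aSheafK (rung2aSheafK_rewindow h2a))

/-- law-carrying form (v41 `Rung2aSheafLaw`; LAW-FREE upgrade `rung2aSheaf_of_rung2aSheafLaw`). [cite: BuchweitzFlenner2003, §5 (I-semiregular)] -/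
theorem hasHyperbolicSeedOn_admTwP_of_rung2aSheafLaw {I : Finset ℕ} {h : ℤ} (h2a : Rung2aSheafLaw C I h) :
    HasHyperbolicSeedOn (twistedReflexiveClass C AdmTwP) 4 1 :=
  hasHyperbolicSeedOn_admTwP_of_rung2aSheaf (rung2aSheaf_of_rung2aSheafLaw h2a)

/-! ## §3 `SheafSeedGaussSq` BY NAME from the sheaf-door rung for every `C` -/

/-- **THE SHEAF-DOOR RUNG FOR EVERY `C` (window and height may depend on `C`) ⟹ `SheafSeedGaussSq`** (stmt-HodgeConjecture-30548) BY NAME, `m = 1`.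
[cite: BuchweitzFlenner2003, §5 (I-semiregular)] [cite: Markman2025SecantWeil, §1.5] -/
theorem sheafSeedGaussSq_of_rung2aSheaf (h2a : ∀ C : ChernCharacterBetti, ∃ (I : Finset ℕ) (h : ℤ), Rung2aSheaf C I h) :
    Summit.HodgeConjecture.HodgeConjecture.Theses.EightfoldTwistedSheafSeeds.SheafSeedGaussSq :=
  sheafSeedGaussSq_of_hyperbolicBFSheafSeedsOn fun C => by
    obtain ⟨I, h, h2⟩ := h2a C
    exact ⟨Finset.Icc 1 8, Finset.isShiftedInitialSegment_Icc le_rfl 8, hasHyperbolicBFSheafSeedOn_of_rung2aSheaf (rung2aSheaf_rewindow h2)⟩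

/-- **THE DIRECTOR'S STUB SHAPE (R19.850 (1)): `(∀ C, Rung2aSheaf C {4} 14) → SheafSeedGaussSq`** — σ₃ ALONE certified, height 14; what
`Lines/sheafdoor.lean`'s `SheafSeedGaussSq_of` can be, verbatim. [cite: BuchweitzFlenner2003, §5 (I-semiregular)] -/
theorem sheafSeedGaussSq_of_rung2aSheaf_four (h2a : ∀ C : ChernCharacterBetti, Rung2aSheaf C {4} 14) :
    Summit.HodgeConjecture.HodgeConjecture.Theses.EightfoldTwistedSheafSeeds.SheafSeedGaussSq :=
  sheafSeedGaussSq_of_rung2aSheaf fun C => ⟨{4}, 14, h2a C⟩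

/-- kernel-orientation variant for every `C`. [cite: BuchweitzFlenner2003, §5 (I-semiregular)] -/
theorem sheafSeedGaussSq_of_rung2aSheafK (h2a : ∀ C : ChernCharacterBetti, ∃ (I : Finset ℕ) (h : ℤ), Rung2aSheafK C I h) :
    Summit.HodgeConjecture.HodgeConjecture.Theses.EightfoldTwistedSheafSeeds.SheafSeedGaussSq :=
  sheafSeedGaussSq_of_hyperbolicBFSheafSeedsOn fun C => by
    obtain ⟨I, h, h2⟩ := h2a C
    exact ⟨Finset.Icc 1 8, Finset.isShiftedInitialSegment_Icc le_rfl 8, hasHyperbolicBFSheafSeedOn_of_rung2aSheafK (rung2aSheafK_rewindow h2)⟩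

/-- law-carrying variant for every `C`. [cite: BuchweitzFlenner2003, §5 (I-semiregular)] -/
theorem sheafSeedGaussSq_of_rung2aSheafLaw (h2a : ∀ C : ChernCharacterBetti, ∃ (I : Finset ℕ) (h : ℤ), Rung2aSheafLaw C I h) :
    Summit.HodgeConjecture.HodgeConjecture.Theses.EightfoldTwistedSheafSeeds.SheafSeedGaussSq :=
  sheafSeedGaussSq_of_rung2aSheaf fun C => by
    obtain ⟨I, h, h2⟩ := h2a C
    exact ⟨I, h, rung2aSheaf_of_rung2aSheafLaw h2⟩

/-! ## §4 The kill path carries over unchanged (recorded): v41 `not_rung2aSheaf_of_rung2bSheaf_of_sPlus` at the CERTIFIED window — a closed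
`SPlus h σ π` + `Rung2bSheaf C {4} σ π` refutes `Rung2aSheaf C {4} h`, hence the stub of R19.850 (1) at that `C`; the budget rider `π` per window is
`SheafDoorWindowBudget.lean` (`π = 0` at `{4}`). -/

/-- the kill path at the window of record, for one `C`. -/
theorem not_rung2aSheaf_four_of_rung2bSheaf_of_sPlus {h : ℤ} {σ : DepthBoundA4.Design → ℤ} {π : ℤ}
    (h2b : Rung2bSheaf C {4} σ π) (hS : RuleDPlate.SPlus h σ π) : ¬ Rung2aSheaf C {4} h :=
  not_rung2aSheaf_of_rung2bSheaf_of_sPlus h2b hS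

/-- AUDIT: wiring only; nothing decided. -/
theorem audit_nothing_decided' : True := trivial

end Summit.HodgeConjecture.HodgeConjecture.Cruxes.BlochSeedDiscOne.RBDoorChainSheafCrux

end
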